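import Summits.AtomisticToContinuum.BoseEinsteinCondensation.Theorems.BECHeatBathGapJastrowDobrushinRungModel
import Literature.MathematicalPhysics.QuantumManyBody.GroundState
import Literature.MathematicalPhysics.QuantumManyBody.BoseGasDirichletWall
import Mathlib.MeasureTheory.Group.LIntegral
import HarnessLib

/-!
# Route `BECHeatBathGap`, crux `SquareSummableInfluence` (stmt-AtomisticToContinuum-14368),
# line `registered`: the rung `jastrow_condDensity_mul_le` / `jastrow_condDensity_le`

Supports (does not close) stmt-AtomisticToContinuum-14368; registered stubs
`jastrow_condDensity_mul_le` and `jastrow_condDensity_le` of line `registered` (a rung: the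
one-particle conditional-density bound (U) of the blind-approximation reduction, verified for
Jastrow baths).

**Statement.** For a measurable `f : ℝ³ → [0, 1]`, the Jastrow pair weight
`w(X) = ∏_{j<l} f(x_j − x_l)²` on `(ℝ³)^N` (`= |Θ_J(X)|²` for the Jastrow amplitude
`Θ_J(X) = ∏_{j<l} f(x_j − x_l)`), a label `i` and a configuration `X`:

`w(X) · (L³ − N ∫_{ℝ³} (1 − f²)) ≤ ∫_{Λ_L} w(X^{i ↦ x}) dx`

in `ℝ≥0∞` with truncated subtraction (`jastrow_condDensity_mul_le`; trivial for `L ≤ 0`), and,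
when `N ∫_{ℝ³} (1 − f²) < L³`, the divided form
`|Θ_J(X)|² ≤ (L³ − N ∫ (1 − f²))⁻¹ ∫_{Λ_L} |Θ_J(X^{i ↦ x})|² dx` (`jastrow_condDensity_le`):
no bath particle is pinned by the others.

## Proof

Factorise `w = B_i · π_i` (`JastrowDobrushin.w_eq_B_mul_pi`), where
`π_i(X) = ∏_{k ≠ i} f(±(x_i − x_k))²` collects the pair factors through `i` and `B_i` the others;
`B_i ∈ [0, 1]` does not depend on `x_i` and `π_i ≤ 1` (`JastrowDobrushin.model_hB`,
`JastrowDobrushin.model_hπ`). Hence `w(X) ≤ B_i(X)` and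
`∫_{Λ_L} w(X^{i ↦ x}) dx = B_i(X) ∫_{Λ_L} π_i(X^{i ↦ x}) dx`, and it remains to bound the last
integral below by `L³ − N ∫ (1 − f²)`: pointwise
`π_i(X^{i ↦ x}) ≥ 1 − ∑_{k ≠ i} (1 − f(±(x − x_k))²)` (`JastrowDobrushin.one_sub_prod_le_sum`),
`∫_{Λ_L} 1 = L³` (`volume_box`), and each of the `N − 1 ≤ N` deficits satisfies
`∫_{Λ_L} (1 − f(±(x − x_k))²) dx ≤ ∫_{ℝ³} (1 − f²)` by monotonicity in the domain and
translation/reflection invariance of Lebesgue measure (`lintegral_sub_left_eq_self`,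
`lintegral_sub_right_eq_self`). The corollary divides by the (positive, finite) constant after
identifying `‖∏ (f … : ℂ)‖₊² = ofReal (∏ f …²)`.

No new definitions; `[folklore]`.
-/

noncomputable section

open MeasureTheory Filter
open scoped ENNReal NNReal Topology

namespace Summit.AtomisticToContinuum.BoseEinsteinCondensation.Theorems.SquareSummableInfluence

open Literature.MathematicalPhysics.QuantumManyBody.BoseGas
open Summit.AtomisticToContinuum.BoseEinsteinCondensation.Theorems

/-! ### Bookkeeping lemmas -/

/-- The deficit estimate in `ℝ≥0∞` over a finite index set: for `g_k ∈ [0, 1]` (`k ∈ s`),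
`1 − ∑_{k ∈ s} ofReal (1 − g_k) ≤ ofReal (∏_{k ∈ s} g_k)` (from `1 − ∏ g ≤ ∑ (1 − g)`).
[folklore] -/
private theorem one_sub_finsetSum_le_ofReal_prod {κ : Type*} (s : Finset κ) (g : κ → ℝ)
    (hg : ∀ k ∈ s, 0 ≤ g k ∧ g k ≤ 1) :
    1 - ∑ k ∈ s, ENNReal.ofReal (1 - g k) ≤ ENNReal.ofReal (∏ k ∈ s, g k) := by
  have hreal : (1 : ℝ) ≤ ∏ k ∈ s, g k + ∑ k ∈ s, (1 - g k) := by
    have h := JastrowDobrushin.one_sub_prod_le_sum s g hg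
    linarith
  rw [tsub_le_iff_right]
  calc (1 : ℝ≥0∞) = ENNReal.ofReal 1 := ENNReal.ofReal_one.symm
    _ ≤ ENNReal.ofReal (∏ k ∈ s, g k + ∑ k ∈ s, (1 - g k)) := ENNReal.ofReal_le_ofReal hreal
    _ = ENNReal.ofReal (∏ k ∈ s, g k) + ENNReal.ofReal (∑ k ∈ s, (1 - g k)) :=
        ENNReal.ofReal_add (Finset.prod_nonneg fun k hk => (hg k hk).1)
          (Finset.sum_nonneg fun k hk => sub_nonneg.2 (hg k hk).2)
    _ = ENNReal.ofReal (∏ k ∈ s, g k) + ∑ k ∈ s, ENNReal.ofReal (1 - g k) := by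
        rw [ENNReal.ofReal_sum_of_nonneg fun k hk => sub_nonneg.2 (hg k hk).2]

/-- The one-particle deficits over the box are at most the total deficit, in both orientations:
`∫_{Λ_L} (1 − f(z − x)²) dx ≤ ∫_{ℝ³} (1 − f²)` and `∫_{Λ_L} (1 − f(x − z)²) dx ≤ ∫_{ℝ³} (1 − f²)`
(monotonicity in the domain; reflection and translation invariance of Lebesgue measure).
[folklore] -/
private theorem setLIntegral_box_deficit_le (L : ℝ) (f : Space → ℝ) (z : Space) :
    ∫⁻ x in box L, ENNReal.ofReal (1 - f (z - x) ^ 2) ≤ ∫⁻ y, ENNReal.ofReal (1 - f y ^ 2) ∧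
      ∫⁻ x in box L, ENNReal.ofReal (1 - f (x - z) ^ 2) ≤ ∫⁻ y, ENNReal.ofReal (1 - f y ^ 2) := by
  constructor
  · calc ∫⁻ x in box L, ENNReal.ofReal (1 - f (z - x) ^ 2)
        ≤ ∫⁻ x, ENNReal.ofReal (1 - f (z - x) ^ 2) := setLIntegral_le_lintegral _ _
      _ = ∫⁻ y, ENNReal.ofReal (1 - f y ^ 2) :=
          lintegral_sub_left_eq_self (fun y => ENNReal.ofReal (1 - f y ^ 2)) z
  · calc ∫⁻ x in box L, ENNReal.ofReal (1 - f (x - z) ^ 2)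
        ≤ ∫⁻ x, ENNReal.ofReal (1 - f (x - z) ^ 2) := setLIntegral_le_lintegral _ _
      _ = ∫⁻ y, ENNReal.ofReal (1 - f y ^ 2) :=
          lintegral_sub_right_eq_self (fun y => ENNReal.ofReal (1 - f y ^ 2)) z

/-- **A product of `[0, 1]`-valued one-particle factors integrates to almost the volume**: if
`g_k : ℝ³ → [0, 1]` (`k ∈ s`) are measurable with deficits `∫_{Λ_L} (1 − g_k) ≤ δ`, then
`L³ − |s| δ ≤ ∫_{x ∈ Λ_L} ∏_{k ∈ s} g_k(x) dx` (truncated subtraction in `ℝ≥0∞`;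
`1 − ∏ ≤ ∑ (1 − ·)` and `∫_{Λ_L} 1 = L³`). [folklore] -/
private theorem volume_sub_le_setLIntegral_box_finsetProd {κ : Type*} (s : Finset κ) (L : ℝ)
    (g : κ → Space → ℝ) (δ : ℝ≥0∞) (hgm : ∀ k ∈ s, Measurable (g k))
    (hg01 : ∀ k ∈ s, ∀ x, 0 ≤ g k x ∧ g k x ≤ 1)
    (hδ : ∀ k ∈ s, ∫⁻ x in box L, ENNReal.ofReal (1 - g k x) ≤ δ) :
    ENNReal.ofReal L ^ 3 - (s.card : ℝ≥0∞) * δ ≤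
      ∫⁻ x in box L, ENNReal.ofReal (∏ k ∈ s, g k x) := by
  have hDm : ∀ k ∈ s, Measurable fun x => ENNReal.ofReal (1 - g k x) := fun k hk =>
    (measurable_const.sub (hgm k hk)).ennreal_ofReal
  calc ENNReal.ofReal L ^ 3 - (s.card : ℝ≥0∞) * δ
      ≤ ENNReal.ofReal L ^ 3 - ∫⁻ x in box L, ∑ k ∈ s, ENNReal.ofReal (1 - g k x) := by
        refine tsub_le_tsub_left ?_ _
        calc ∫⁻ x in box L, ∑ k ∈ s, ENNReal.ofReal (1 - g k x)
            = ∑ k ∈ s, ∫⁻ x in box L, ENNReal.ofReal (1 - g k x) := lintegral_finsetSum _ hDm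
          _ ≤ ∑ _k ∈ s, δ := Finset.sum_le_sum hδ
          _ = (s.card : ℝ≥0∞) * δ := by rw [Finset.sum_const, nsmul_eq_mul]
    _ = (∫⁻ _ in box L, (1 : ℝ≥0∞)) - ∫⁻ x in box L, ∑ k ∈ s, ENNReal.ofReal (1 - g k x) := by
        rw [setLIntegral_const, one_mul, volume_box]
    _ ≤ ∫⁻ x in box L, (1 - ∑ k ∈ s, ENNReal.ofReal (1 - g k x)) :=
        lintegral_sub_le _ _ (Finset.measurable_sum _ hDm)
    _ ≤ ∫⁻ x in box L, ENNReal.ofReal (∏ k ∈ s, g k x) :=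
        lintegral_mono fun x =>
          one_sub_finsetSum_le_ofReal_prod s (fun k => g k x) fun k hk => hg01 k hk x

/-- `(‖r‖₊)² = ofReal (r²)` in `ℝ≥0∞` for a real number cast to `ℂ`. [folklore] -/
private theorem coe_nnnorm_ofReal_sq (r : ℝ) :
    (‖(r : ℂ)‖₊ : ℝ≥0∞) ^ 2 = ENNReal.ofReal (r ^ 2) := by
  rw [Complex.nnnorm_real, ← sq_abs, ← Real.norm_eq_abs, ENNReal.ofReal_pow (norm_nonneg _),
    ofReal_norm, enorm_eq_nnnorm]

/-- The Jastrow amplitude and the Jastrow weight: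
`‖∏_{j<l} (r_{jl} : ℂ)‖₊² = ofReal (∏_{j<l} r_{jl}²)` in `ℝ≥0∞`, for real `r_{jl}`. [folklore] -/
private theorem coe_nnnorm_pairProd_ofReal_sq {N : ℕ} (r : Fin N → Fin N → ℝ) :
    (‖∏ j : Fin N, ∏ l ∈ Finset.univ.filter (fun l => j < l), (r j l : ℂ)‖₊ : ℝ≥0∞) ^ 2 =
      ENNReal.ofReal (∏ j : Fin N, ∏ l ∈ Finset.univ.filter (fun l => j < l), r j l ^ 2) := by
  have h : (∏ j : Fin N, ∏ l ∈ Finset.univ.filter (fun l => j < l), (r j l : ℂ)) =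
      ((∏ j : Fin N, ∏ l ∈ Finset.univ.filter (fun l => j < l), r j l : ℝ) : ℂ) := by
    push_cast
    rfl
  rw [h, coe_nnnorm_ofReal_sq]
  simp only [Finset.prod_pow]

/-- Division by a positive finite constant in `ℝ≥0∞`: `a d ≤ b ⇒ a ≤ d⁻¹ b`. [folklore] -/
private theorem le_inv_mul_of_mul_le {a b d : ℝ≥0∞} (hd0 : d ≠ 0) (hdtop : d ≠ ⊤)
    (h : a * d ≤ b) : a ≤ d⁻¹ * b :=
  (ENNReal.mul_le_iff_le_inv hd0 hdtop).1 ((mul_comm d a).trans_le h)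

/-! ### The stubs -/

/-- **Rung of line `registered` of the crux `SquareSummableInfluence`: the one-particle
conditional-density bound (U) for Jastrow baths, division-free form.** For measurable
`f : ℝ³ → [0, 1]`, the pair weight `w(X) = ∏_{j<l} f(x_j − x_l)²`, every label `i` and every
configuration `X`: `w(X) · (L³ − N ∫_{ℝ³} (1 − f²)) ≤ ∫_{Λ_L} w(X^{i ↦ x}) dx` (in `ℝ≥0∞`,
truncated subtraction). Proof: `w = B_i π_i` with `B_i` independent of `x_i` and `π_i ≤ 1`, so
`w(X) ≤ B_i(X)` and `∫_{Λ_L} w(X^{i ↦ x}) dx = B_i(X) ∫_{Λ_L} π_i(X^{i ↦ x}) dx ≥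
B_i(X) (L³ − (N − 1) ∫ (1 − f²))`. [folklore] -/
theorem jastrow_condDensity_mul_le :
    ∀ (N : ℕ) (L : ℝ) (f : Space → ℝ), Measurable f → (∀ x, 0 ≤ f x ∧ f x ≤ 1) →
      ∀ (i : Fin N) (X : Config N),
        ENNReal.ofReal (∏ j : Fin N, ∏ l ∈ Finset.univ.filter (fun l => j < l), f (X j - X l) ^ 2) *
            (ENNReal.ofReal L ^ 3 - (N : ℝ≥0∞) * ∫⁻ x, ENNReal.ofReal (1 - f x ^ 2)) ≤
          ∫⁻ x in box L, ENNReal.ofReal (∏ j : Fin N, ∏ l ∈ Finset.univ.filter (fun l => j < l),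
            f (Function.update X i x j - Function.update X i x l) ^ 2) := by
  intro N L f hf hf01 i X
  -- the one-site weight `π_i`, its complement `B_i` and the pair weight `w`, as functions
  -- (defining hypotheses of the Jastrow model file hold by `rfl`)
  let πN : Fin N → Config N → ℝ := fun j Y =>
    ∏ k ∈ Finset.univ.erase j, (if k < j then f (Y k - Y j) ^ 2 else f (Y j - Y k) ^ 2)
  let BN : Fin N → Config N → ℝ := fun j Y =>
    ∏ a, ∏ l ∈ Finset.univ.filter (fun l => a < l), (if a = j ∨ l = j then 1 else f (Y a - Y l) ^ 2)
  let wN : Config N → ℝ := fun Y =>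
    ∏ a, ∏ l ∈ Finset.univ.filter (fun l => a < l), f (Y a - Y l) ^ 2
  have hπN : ∀ j Y, πN j Y =
      ∏ k ∈ Finset.univ.erase j, (if k < j then f (Y k - Y j) ^ 2 else f (Y j - Y k) ^ 2) :=
    fun _ _ => rfl
  have hBN : ∀ j Y, BN j Y = ∏ a, ∏ l ∈ Finset.univ.filter (fun l => a < l),
      (if a = j ∨ l = j then 1 else f (Y a - Y l) ^ 2) := fun _ _ => rfl
  have hwN : ∀ Y, wN Y = ∏ a, ∏ l ∈ Finset.univ.filter (fun l => a < l), f (Y a - Y l) ^ 2 :=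
    fun _ => rfl
  have hfac := JastrowDobrushin.w_eq_B_mul_pi hπN hBN hwN i
  obtain ⟨-, hπ01⟩ := JastrowDobrushin.model_hπ hf hf01 hπN i
  obtain ⟨-, hB01, hBinv⟩ := JastrowDobrushin.model_hB hf hf01 hBN i
  have hsq : ∀ x, 0 ≤ f x ^ 2 ∧ f x ^ 2 ≤ 1 := fun x =>
    ⟨sq_nonneg _, pow_le_one₀ (hf01 x).1 (hf01 x).2⟩
  -- `w ≤ B_i`
  have hwB : wN X ≤ BN i X := by
    rw [hfac X]
    exact mul_le_of_le_one_right (hB01 X).1 (hπ01 X).2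
  -- the fibre integral of `π_i` is almost the volume
  have hkey : ENNReal.ofReal L ^ 3 - (N : ℝ≥0∞) * ∫⁻ x, ENNReal.ofReal (1 - f x ^ 2) ≤
      ∫⁻ x in box L, ENNReal.ofReal (πN i (Function.update X i x)) := by
    simp only [JastrowDobrushin.pi_update_eq hπN i X]
    have h := volume_sub_le_setLIntegral_box_finsetProd (Finset.univ.erase i) L
      (fun k x => if k < i then f (X k - x) ^ 2 else f (x - X k) ^ 2)
      (∫⁻ y, ENNReal.ofReal (1 - f y ^ 2))
      (fun k _ => by
        by_cases h : k < i
        · simp only [h, ↓reduceIte]; exact (hf.comp (measurable_const_sub (X k))).pow_const 2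
        · simp only [h, ↓reduceIte]; exact (hf.comp (measurable_sub_const (X k))).pow_const 2)
      (fun k _ x => by
        by_cases h : k < i
        · simp only [h, ↓reduceIte]; exact hsq _
        · simp only [h, ↓reduceIte]; exact hsq _)
      (fun k _ => by
        by_cases h : k < i
        · simp only [h, ↓reduceIte]; exact (setLIntegral_box_deficit_le L f (X k)).1
        · simp only [h, ↓reduceIte]; exact (setLIntegral_box_deficit_le L f (X k)).2)
    refine le_trans (tsub_le_tsub_left (mul_le_mul' ?_ le_rfl) _) h
    exact_mod_cast (Finset.card_le_univ _).trans_eq (Fintype.card_fin N)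
  -- assemble
  show ENNReal.ofReal (wN X) * _ ≤ ∫⁻ x in box L, ENNReal.ofReal (wN (Function.update X i x))
  calc ENNReal.ofReal (wN X) *
        (ENNReal.ofReal L ^ 3 - (N : ℝ≥0∞) * ∫⁻ x, ENNReal.ofReal (1 - f x ^ 2))
      ≤ ENNReal.ofReal (BN i X) * ∫⁻ x in box L, ENNReal.ofReal (πN i (Function.update X i x)) :=
        mul_le_mul' (ENNReal.ofReal_le_ofReal hwB) hkey
    _ = ∫⁻ x in box L, ENNReal.ofReal (BN i X) * ENNReal.ofReal (πN i (Function.update X i x)) :=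
        (lintegral_const_mul' _ _ ENNReal.ofReal_ne_top).symm
    _ = ∫⁻ x in box L, ENNReal.ofReal (wN (Function.update X i x)) := by
        refine lintegral_congr fun x => ?_
        rw [hfac, hBinv, ENNReal.ofReal_mul (hB01 X).1]

/-- **Rung of line `registered` of the crux `SquareSummableInfluence`: the one-particle
conditional-density bound (U) for Jastrow baths.** For measurable `f : ℝ³ → [0, 1]` with
`N ∫_{ℝ³} (1 − f²) < L³` and the Jastrow amplitude `Θ_J(X) = ∏_{j<l} f(x_j − x_l)`, every label
`i` and configuration `X`:
`|Θ_J(X)|² ≤ (L³ − N ∫ (1 − f²))⁻¹ ∫_{Λ_L} |Θ_J(X^{i ↦ x})|² dx` — no bath particle is pinned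
by the others, with the constant of the normalisation deficit. Corollary of
`jastrow_condDensity_mul_le` (`|Θ_J|² = ∏_{j<l} f²`). [folklore] -/
theorem jastrow_condDensity_le :
    ∀ (N : ℕ) (L : ℝ) (f : Space → ℝ), Measurable f → (∀ x, 0 ≤ f x ∧ f x ≤ 1) →
      (N : ℝ≥0∞) * (∫⁻ x, ENNReal.ofReal (1 - f x ^ 2)) < ENNReal.ofReal L ^ 3 →
      ∀ (i : Fin N) (X : Config N),
        (‖(∏ j : Fin N, ∏ l ∈ Finset.univ.filter (fun l => j < l),
          (f (X j - X l) : ℂ))‖₊ : ℝ≥0∞) ^ 2 ≤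
          (ENNReal.ofReal L ^ 3 - (N : ℝ≥0∞) * ∫⁻ x, ENNReal.ofReal (1 - f x ^ 2))⁻¹ *
            ∫⁻ x in box L, (‖(∏ j : Fin N, ∏ l ∈ Finset.univ.filter (fun l => j < l),
              (f (Function.update X i x j - Function.update X i x l) : ℂ))‖₊ : ℝ≥0∞) ^ 2 := by
  intro N L f hf hf01 hlt i X
  have key : ∀ Y : Config N,
      (‖∏ j : Fin N, ∏ l ∈ Finset.univ.filter (fun l => j < l), (f (Y j - Y l) : ℂ)‖₊ : ℝ≥0∞) ^ 2 =
        ENNReal.ofReal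
          (∏ j : Fin N, ∏ l ∈ Finset.univ.filter (fun l => j < l), f (Y j - Y l) ^ 2) :=
    fun Y => coe_nnnorm_pairProd_ofReal_sq fun j l => f (Y j - Y l)
  simp only [key]
  exact le_inv_mul_of_mul_le (tsub_pos_of_lt hlt).ne'
    (ne_top_of_le_ne_top (ENNReal.pow_ne_top ENNReal.ofReal_ne_top) tsub_le_self)
    (jastrow_condDensity_mul_le N L f hf hf01 i X)

end Summit.AtomisticToContinuum.BoseEinsteinCondensation.Theorems.SquareSummableInfluence

end
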